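import Summits.HubbardSuperconductivity.HubbardSuperconductivity.Theorems.BcsKacWindowInfraredCompletionSqrtShape

/-!
# Crux `InfraredCompletion` (stmt-HubbardSuperconductivity-1321, route BcsKacWindow), line `birth`:
# below `L < 2πt/Δ(U)` the soft window is the zero mode alone

Pure lattice bookkeeping on the discrete torus `(ℤ/Lℤ)²` (registered sub-goal
`softWindowSum_eq_zero_mode_of_lt` of skeleton v5). The soft window of stub A (`stub_softWindowFloor`)
is the set of momentum labels `m` with `|q_m|² = momentumNormSq L m ≤ r²`, `r = Δ(U)/t`. Every
nonzero label has `|q_m|² ≥ (2π/L)²` (its least-absolute-value representative has sup-norm `≥ 1`,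
`WcbcsSsbToTorusLRO.one_le_latLinf`, `WcbcsSsbToTorusLRO.latLinf_sq_le_momentumNormSq`), so for a
radius `0 ≤ r < 2π/L` the window is `{0}` and the window sum of the pair structure factor is the single
zero-mode term `S_ψ(0) = Re⟨ψ, Δ_d†Δ_d ψ⟩ / L²` (`pairStructureFactor_zero`):

* `softWindowSum_eq_zero_mode_of_lt` — `Σ_{|q_m|² ≤ r²} S_ψ(m) = S_ψ(0)` for `0 ≤ r < 2π/L`;
* `softWindowFloor_iff_order_of_lt` — hence, on such a torus, stub A's soft-window floor
  `c · L² ≤ Σ_{|q_m|² ≤ r²} S_ψ(m)` IS the crux's bulk-order conclusion `c ≤ Re⟨Δ_d†Δ_d⟩ / L⁴`.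

In the crux's variables (`r = Δ(U)/t`) the hypothesis `r < 2π/L` reads `L < 2πt/Δ(U)`: on the sides
`t/Δ(U) ≤ L < 2πt/Δ(U)` stub A restricted there is the crux conclusion verbatim; only beyond is it a
coarse-grained (size-transfer) floor. No definition, no named fact, `sorry`-free.

Source: T. Kennedy, E. H. Lieb, B. S. Shastry, PRL **61** (1988) 2582 (Fourier modes of the order
operator on the torus and the zero mode as the long-range-order quantity). [folklore]
-/

noncomputable section

-- the mandated namespace `Summit.<Summit>.<Problem>.Theorems…` repeats `HubbardSuperconductivity`
-- (single-problem summit, D-0017), which the `dupNamespace` linter flags on every declaration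
set_option linter.dupNamespace false

namespace Summit.HubbardSuperconductivity.HubbardSuperconductivity.Theorems.InfraredCompletion

open Literature.MathematicalPhysics.QuantumLattice Literature.Probability.LatticeModels
open Summit.HubbardSuperconductivity.HubbardSuperconductivity.Theorems.WcbcsSsbToTorusLRO
  (one_le_latLinf latLinf_sq_le_momentumNormSq)
open scoped Matrix

/-- **The first nonzero shell.** A nonzero momentum label `m ∈ (ℤ/Lℤ)²` has
`(2π/L)² ≤ |q_m|²`: its least-absolute-value representative has sup-norm `j ≥ 1`
(`one_le_latLinf`) and `|q_m|² ≥ (2π/L)² j²` (`latLinf_sq_le_momentumNormSq`).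
Kennedy–Lieb–Shastry, PRL 61 (1988) 2582. [folklore] -/
theorem wib_sq_le_momentumNormSq_of_ne_zero {L : ℕ} {m : TorusSite 2 L} (hm : m ≠ 0) :
    (2 * Real.pi / (L : ℝ)) ^ 2 ≤ momentumNormSq L m := by
  have hj : (1 : ℝ) ≤ ((max (m 0).valMinAbs.natAbs (m 1).valMinAbs.natAbs : ℕ) : ℝ) := by
    exact_mod_cast one_le_latLinf hm
  calc (2 * Real.pi / (L : ℝ)) ^ 2 = (2 * Real.pi / (L : ℝ)) ^ 2 * 1 ^ 2 := by ring
    _ ≤ (2 * Real.pi / (L : ℝ)) ^ 2 *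
          ((max (m 0).valMinAbs.natAbs (m 1).valMinAbs.natAbs : ℕ) : ℝ) ^ 2 :=
        mul_le_mul_of_nonneg_left (pow_le_pow_left₀ zero_le_one hj 2) (sq_nonneg _)
    _ ≤ momentumNormSq L m := latLinf_sq_le_momentumNormSq m

/-- **Below `L < 2πt/Δ(U)` the soft window is the zero mode alone.** For any vector `ψ` on the
fermionic torus of side `L` and any radius `0 ≤ r < 2π/L`, the soft-window sum of the `d`-wave pair
structure factor is its zero mode: `Σ_{m : |q_m|² ≤ r²} S_ψ(m) = S_ψ(0)`. Indeed `|q_0|² = 0 ≤ r²`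
(`momentumNormSq_zero`), while every `m ≠ 0` has `|q_m|² ≥ (2π/L)² > r²`
(`wib_sq_le_momentumNormSq_of_ne_zero`; `0 ≤ r` turns `r < 2π/L` into `r² < (2π/L)²`), so the window
is `{0}` (`Finset.sum_eq_single_of_mem`). Registered sub-goal of skeleton v5 of line `birth`.
Kennedy–Lieb–Shastry, PRL 61 (1988) 2582. [folklore] -/
theorem softWindowSum_eq_zero_mode_of_lt :
    ∀ (L : ℕ) [NeZero L] (ψ : Fock (Orb (FermionTorus 2 L))) (r : ℝ), 0 ≤ r →
      r < 2 * Real.pi / (L : ℝ) →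
      ∑ m ∈ Finset.univ.filter (fun m : Fin 2 → ZMod L => momentumNormSq L m ≤ r ^ 2),
        pairStructureFactor dWaveFormFactor L ψ m = pairStructureFactor dWaveFormFactor L ψ 0 := by
  intro L _ ψ r hr hrL
  have hr2 : r ^ 2 < (2 * Real.pi / (L : ℝ)) ^ 2 := pow_lt_pow_left₀ hrL hr two_ne_zero
  refine Finset.sum_eq_single_of_mem 0 ?_ fun m hm hm0 => ?_
  · rw [Finset.mem_filter, momentumNormSq_zero]
    exact ⟨Finset.mem_univ _, sq_nonneg _⟩
  · exact absurd ((Finset.mem_filter.1 hm).2.trans_lt hr2)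
      (not_lt.2 (wib_sq_le_momentumNormSq_of_ne_zero hm0))

/-- **Stub A's floor IS the order below `L < 2πt/Δ(U)`**: below `L < 2πt/Δ(U)` (window radius
`r = Δ(U)/t < 2π/L`) stub A's soft-window floor IS the crux's bulk-order conclusion. Precisely, for
any vector `ψ`, any level `c` and any radius `0 ≤ r < 2π/L`,
`c · L² ≤ Σ_{m : |q_m|² ≤ r²} S_ψ(m) ↔ c ≤ Re⟨ψ, Δ_d†Δ_d ψ⟩ / L⁴`, because the window sum is
`S_ψ(0)` (`softWindowSum_eq_zero_mode_of_lt`) and `S_ψ(0) = Re⟨ψ, Δ_d†Δ_d ψ⟩ / L²`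
(`pairStructureFactor_zero`). Kennedy–Lieb–Shastry, PRL 61 (1988) 2582. [folklore] -/
theorem softWindowFloor_iff_order_of_lt (L : ℕ) [NeZero L] (ψ : Fock (Orb (FermionTorus 2 L)))
    (c r : ℝ) (hr : 0 ≤ r) (hrL : r < 2 * Real.pi / (L : ℝ)) :
    (c * (L : ℝ) ^ 2 ≤
        ∑ m ∈ Finset.univ.filter (fun m : Fin 2 → ZMod L => momentumNormSq L m ≤ r ^ 2),
          pairStructureFactor dWaveFormFactor L ψ m) ↔
      (c ≤ (expect ((pairField dWaveFormFactor L)ᴴ * pairField dWaveFormFactor L) ψ).re /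
        (L : ℝ) ^ 4) := by
  have hL0 : (0 : ℝ) < (L : ℝ) := Nat.cast_pos.2 (Nat.pos_of_ne_zero (NeZero.ne L))
  have hL2 : (0 : ℝ) < (L : ℝ) ^ 2 := by positivity
  have hL4 : (0 : ℝ) < (L : ℝ) ^ 4 := by positivity
  rw [softWindowSum_eq_zero_mode_of_lt L ψ r hr hrL, pairStructureFactor_zero dWaveFormFactor L ψ,
    le_div_iff₀ hL2, le_div_iff₀ hL4,
    show c * (L : ℝ) ^ 2 * (L : ℝ) ^ 2 = c * (L : ℝ) ^ 4 by ring]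

end Summit.HubbardSuperconductivity.HubbardSuperconductivity.Theorems.InfraredCompletion

end
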